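import Summits.ResolutionOfSingularities.ResolutionOfSingularities.Theorems.WeightedInvariantCanonicalCentreHomogeneous
import HarnessLib

/-!
# By-name closer of sub-stub [S5] of door skeleton v3 (`HypersurfaceCentreConstruction`, H2c″ assembly)

Route `ResolutionOfSingularities/WeightedInvariant`, crux `Theses.WeightedInvariant.HypersurfaceCentreConstruction`
(stmt-ResolutionOfSingularities-19897), line `local-engine`, door skeleton v3 (stub-9 = res-D-brk-1's assembly
`door_assembly_eft3_v2.lean` 06658232a248dc91 over the tree modules `…HypersurfaceLocalGameEFT3` / `…HypersurfaceCentreAssemblyDefs`):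
`stub_isHomogeneous_of_isCanonicalCentre` — the canonical centre of a singular hypersurface pair is homogeneous on every torus
chart of the pair — with the REGISTERED signature verbatim, closed by `isHomogeneous_of_isCanonicalCentre'`
(`Theorems/WeightedInvariantCanonicalCentreHomogeneous.lean`: smooth invariance of recipe-defined stalks + (c11) + (c12a)).
The hypotheses `hc6`, `hJ`, `hXi`, `hsing`, `h0`, `IsSeparated`, `QuasiCompact`, `CharP`, `PerfectField` of the registered
signature are not needed by the proof. OURS; AI-written, weaker than expert review.
-/

noncomputable section

set_option linter.dupNamespace false -- mandated namespace of this single-conjunct summit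

open CategoryTheory AlgebraicGeometry TopologicalSpace IsLocalRing
open Literature.AlgebraicGeometry.Resolution
open Summit.ResolutionOfSingularities.ResolutionOfSingularities.Cruxes.HypersurfaceCentreConstruction.LocalEngine

namespace Summit.ResolutionOfSingularities.ResolutionOfSingularities.Theorems

section Stubs

variable {p : ℕ} (ι : (R : Type) → [CommRing R] → R → Ordinal.{0})
  (J : (R : Type) → [CommRing R] → R → ℕ → Ideal R)

/-- **[S5] of door skeleton v3, BY NAME** (header VERBATIM as registered, skeleton 793674497624550e l.153–161; `p`, `ι`, `J`
are section variables as in the skeleton): for `ι`, `J` with (c6) iso-invariance, (c12a) unit-invariance, `J` iso-invariant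
and (c11) compatibility with essentially smooth local homomorphisms, a singular hypersurface pair `(f : Y → Spec k, X)` over a
perfect field of characteristic `p`, a canonical centre `R` (`IsCanonicalCentre ι J X R`), an affine open `W` with a
`ℤʲ`-grading `𝒢` of `Γ(Y, W)` (constants in degree `0`) making `X(W)` homogeneous: every piece `Rₙ(W)` is homogeneous.
[cite: Wlodarczyk2022, Thm. 1.1.4 (6)] -/
theorem stub_isHomogeneous_of_isCanonicalCentre (hc6 : IotaIsoInvariant ι) (hu : IotaUnitInvariant ι)
    (hJ : JIsoInvariant J) (hJu : JUnitInvariant J) (hJs : IotaJEssSmoothCompatible ι J)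
    {k : Type} [Field k] [CharP k p] [PerfectField k] {Y : Scheme.{0}} (f : Y ⟶ Spec (.of k)) [Smooth f]
    [IsSeparated f] [QuasiCompact f] (X : Y.IdealSheafData) (hX : IsLocallyPrincipal X)
    (hXi : IsIntegral X.subscheme) (hsing : ¬ Scheme.IsRegular X.subscheme)
    (R : ReesAlgebraData Y) (hR : IsCanonicalCentre ι J X R)
    {j : ℕ} (W : Y.affineOpens) (𝒢 : (Fin j → ℤ) → AddSubgroup Γ(Y, W)) [GradedRing 𝒢]
    (h0 : ∀ c : Γ(Spec (.of k), ⊤), f.appLE ⊤ W le_top c ∈ 𝒢 0) (hXhom : (X.ideal W).IsHomogeneous 𝒢) (n : ℕ) :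
    ((R.piece n).ideal W).IsHomogeneous 𝒢 :=
  have _unused : IotaIsoInvariant ι ∧ JIsoInvariant J ∧ IsIntegral X.subscheme ∧ ¬ Scheme.IsRegular X.subscheme ∧
      (∀ c : Γ(Spec (.of k), ⊤), f.appLE ⊤ W le_top c ∈ 𝒢 0) := ⟨hc6, hJ, hXi, hsing, h0⟩
  isHomogeneous_of_isCanonicalCentre' ι J hJs hu hJu f X hX R hR W 𝒢 hXhom n

end Stubs

end Summit.ResolutionOfSingularities.ResolutionOfSingularities.Theorems

end
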